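import Summits.ResolutionOfSingularities.ResolutionOfSingularities.Theorems.FrobeniusLadderFRationalResolutionPrincipalDescent
import Literature.AlgebraicGeometry.Resolution.EffectiveCartierStalks
import Literature.AlgebraicGeometry.Resolution.StalkIdealLemmas
import Mathlib.AlgebraicGeometry.Morphisms.Flat
import HarnessLib

/-!
# Crux `FrobeniusLadder.FRationalResolution` (stmt-ResolutionOfSingularities-15317), line `redirect`,
# stub `stub_diagonalizableQuotientResolution` — EFFECTIVE CARTIER DIVISORS DESCEND along flat surjective morphisms

The converse of the tree's `IsEffectiveCartier.comap_of_flat` (pull-back along flat morphisms), for a locally Noetherian target: if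
`f : Y → X` is flat and surjective and `f⁻¹K·𝒪_Y` is an effective Cartier divisor, then so is `K`. Stalkwise: `𝒪_{X,f y} → 𝒪_{Y,y}` is
flat and local, hence faithfully flat; `(f⁻¹K)_y = K_{f y}·𝒪_{Y,y}` (`stalkIdeal_comap_eq_map_stalkMap`) is principal generated by a
nonzerodivisor, so `K_{f y}` is (`…PrincipalDescent.Ideal.exists_generator_of_map_eq_span_singleton`), i.e. every point of `X` lies in
the Cartier locus (`isEffectiveCartier_iff_forall_mem_cartierLocus`). Use in the Galois route: the Cartier hypothesis on the twists
of a piece on `Bl_{I₁}(Spec B'_h)` (→ `…GaloisSymmetrizedPieceRegular`, `…BlowupAbsorbsCartier`) may be checked after the étale base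
change to the chart side, where the centres are monomial.

* `mem_cartierLocus_of_flat_stalkMap` — one point: `y ∈ cartierLocus (f⁻¹K)`, `f_y^♯` flat ⇒ `f y ∈ cartierLocus K`;
* **`IsEffectiveCartier.of_comap_of_flat_of_surjective`** — the statement above.

Honest label: generic scheme plumbing toward ONE leaf stub (no stub, crux or summit closed). No definitions, no named facts, no
sorry. [cite: StacksProject, Tag 02OO; Tag 05B2; Tag 01WS]
-/

noncomputable section

-- single-problem summit: the doubled namespace component is forced
set_option linter.dupNamespace false

open CategoryTheory AlgebraicGeometry
open Literature.AlgebraicGeometry.Resolution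

namespace Summit.ResolutionOfSingularities.ResolutionOfSingularities.Theorems.FRationalResolution.CartierDescentFlat

universe u

/-- **One point.** If `y` lies in the Cartier locus of `f⁻¹K·𝒪_Y` and the stalk map `𝒪_{X, f y} → 𝒪_{Y, y}` is flat, then
`f y` lies in the Cartier locus of `K`. [cite: StacksProject, Tag 02OO; Tag 05B2] -/
theorem mem_cartierLocus_of_flat_stalkMap {X Y : Scheme.{u}} (f : Y ⟶ X) (K : X.IdealSheafData) (y : Y)
    (hflat : (f.stalkMap y).hom.Flat) (hy : y ∈ cartierLocus (K.comap f)) : f y ∈ cartierLocus K := by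
  obtain ⟨g, hg, hgen⟩ := hy
  rw [stalkIdeal_comap_eq_map_stalkMap] at hgen
  letI : Algebra (X.presheaf.stalk (f y)) (Y.presheaf.stalk y) := (f.stalkMap y).hom.toAlgebra
  haveI : Module.Flat (X.presheaf.stalk (f y)) (Y.presheaf.stalk y) := hflat
  haveI : IsLocalHom (algebraMap (X.presheaf.stalk (f y)) (Y.presheaf.stalk y)) :=
    inferInstanceAs (IsLocalHom (f.stalkMap y).hom)
  haveI : Module.FaithfullyFlat (X.presheaf.stalk (f y)) (Y.presheaf.stalk y) :=
    Module.FaithfullyFlat.of_flat_of_isLocalHom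
  obtain ⟨v, -, hv, hKv, -⟩ :=
    PrincipalDescent.Ideal.exists_generator_of_map_eq_span_singleton (stalkIdeal K (f y)) g hg hgen
  exact ⟨v, hv, hKv⟩

/-- **Effective Cartier divisors descend along flat surjective morphisms** (`X` locally Noetherian).
[cite: StacksProject, Tag 02OO; Tag 01WS] -/
theorem IsEffectiveCartier.of_comap_of_flat_of_surjective {X Y : Scheme.{u}} [IsLocallyNoetherian X] (f : Y ⟶ X)
    [Flat f] [Surjective f] (K : X.IdealSheafData) (h : IsEffectiveCartier (K.comap f)) : IsEffectiveCartier K := by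
  rw [isEffectiveCartier_iff_forall_mem_cartierLocus]
  intro x
  obtain ⟨y, rfl⟩ := f.surjective x
  exact mem_cartierLocus_of_flat_stalkMap f K y (Flat.stalkMap f y) (h.mem_cartierLocus y)

end Summit.ResolutionOfSingularities.ResolutionOfSingularities.Theorems.FRationalResolution.CartierDescentFlat

end
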